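import Summits.BirchSwinnertonDyer.BirchSwinnertonDyer.Theorems.EisensteinPrimesMazurMCOnCellBTwistbackOnePartnerCertificates
import Summits.BirchSwinnertonDyer.Rank1Residual.X2.RouteGSplitDisplay194025s1Local
import Summits.BirchSwinnertonDyer.Rank1Residual.X2.RouteGSplitDisplay206016bb1Local
import Summits.BirchSwinnertonDyer.Rank1Residual.X1.DoubleTwistDisplayKit
import Summits.BirchSwinnertonDyer.Rank1Residual.Partition.EisensteinKernelAbscissaType
import Literature.NumberTheory.EllipticCurves.TateCurve.NumberFieldUniformization
import Literature.NumberTheory.EllipticCurves.TateCurve.NumberFieldUniformizationTwisted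
import Literature.NumberTheory.EllipticCurves.HeegnerHypothesisKroneckerProofs
import Literature.NumberTheory.EllipticCurves.HeegnerFieldOfDiscriminantProofs
import Mathlib.Tactic.NormNum.LegendreSymbol
import HarnessLib

/-!
# Crux 3 `MazurMCOnCellB` (stmt-BirchSwinnertonDyer-19033), line `twistback`: PER-PAIR DISPLAYS of A10 non-split cells
# through the LEAD's doors (p640749 §4 / p642512 §5), batch 10 — `194025s1` ⊗ `-179` (door §4); `206016bb1` ⊗ `-71` (door §5)

Seat `bsd-eis-lam-a` g16 (PART 1b seat (4), CONSTRUCTION seat; census ask CA-g9-1 of LEAD `bsd-line-x2-p1` g9); GENERATED by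
`work/disp/gen_display.py` from the farm-checked template `…TwistbackDisplay5568g1.lean` (same seat), Cremona `ecdata`, the
seat's kit jobs j311785 (partners: PARI `ellanalyticrank`/`ellminimalmodel`) and j311944–j312039 (ENGINE T readings) — below the
module docstring nothing is hand-edited. For each cell `(E, 3)` of row A10 NON-split (`r_an = 0`, `3 ‖ N` non-split, `E[3]`
reducible, type A = `¬GVPar`): the PARTNER is `Wd = E ⊗ χ_{d_K}` for a Heegner-admissible odd fundamental `d_K < −4` with
`r_an(Wd) = 1` — one of the cell's three tested candidates (all of rank exactly 1; the seat's readings table says which were read)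
that carries the door's certificate (`λ_an = 1` for §5, else a certified `ord_{T=0} = 1` for §4) —, an X2c ∩ `GVPar` pair non-split at `3`.
KERNEL-PROVED per cell (no hypothesis): `X2.CellB E 3` given the rank reading — incl. **`¬GVPar` from the abscissa alone**
(integer `Ψ₃`-root `x₀` with `b₂ + 12x₀ > 0`; `KernelDisc.gvPar_three_iff_abscissa_of_mult`, Tate facts discharged), `3`
non-split and `E[3]` reducible (the route-G Local lemmas `nonsplit_<E>`, `not_irreducible_<E>` BY NAME), ellipticity and GLOBAL
MINIMALITY of `Wd` where the tree's bounded Kraus–Silverman criterion applies (else an instance hypothesis = PARI `ellminimalmodel`, said per cell), the twist identity `C⁻¹ • Wd = E.quadraticTwist d_K`, and from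
`d_K` alone: `IsImaginaryQuadratic K`, `Odd d_K`, `d_K < −4`, the Heegner hypotheses for `N` and for `3` (Kronecker criterion).
HYPOTHESES LEFT per cell: readings `hr` (`r_an(E) = 0`, Cremona), `hN` (`N`, Cremona — the additive conductor exponents are not
re-derived), `hrd` (`r_an(Wd) = 1`, PARI), and either `hμ0`/`hlam` (`(μ_an,λ_an)(Wd,3) = (0,1)`, door §5) or `hordL`
(`ord_{T=0} ϖL₃(Wd) = 1`, door §4) [ENGINE T twisted Birch sum ‖ PARI where `msfromell` fits; seat memo MEMO-16]; the Heegner DATUM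
over `K` (`Dt`, `H`, `ι`, `P`, `hPt`, `hcM`) and STEP L there (`hlow` = item -27489 ⇐ Keller–Yin Thm. D [PREPRINT] + PUB);
class-level inputs BY NAME: `PublishedInputs` (item 19037), Disegni 2020 Thm. 4(1).
HONEST FRAMING: displays only; every cell stays OPEN (PRE input + datum + readings); Mazur's MC / BSD proved for NO curve; no
summit statement is proved; 0 cells / labels / tiers move. References: [GreenbergVatsal2000] Thm. (1.3), p. 4; [Disegni2020]
Thm. 4 (§3.2); [SteinWuthrich2013] Thm. 6.1; [Wuthrich2014] Thm. 16; [SilvermanATAEC1994] Thm. V.5.3, Cor. V.5.4;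
[GrossLMS1991] §1; Cremona `ecdata`.
-/

set_option autoImplicit false

-- `Summit.BirchSwinnertonDyer.BirchSwinnertonDyer.…`: the summit and its single sub-problem share a name.
set_option linter.dupNamespace false

noncomputable section

open scoped Classical MatrixGroups ModularForm

open CongruenceSubgroup WeierstrassCurve NumberField
  Literature.NumberTheory.EllipticCurves
  Literature.NumberTheory.EllipticCurves.ModularForms
  Literature.NumberTheory.EllipticCurves.Rank1Residual
  Literature.NumberTheory.EllipticCurves.Rank1Residual.Typed
  Literature.NumberTheory.EllipticCurves.Rank1Residual.X11RankOneCertificates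
  Literature.NumberTheory.EllipticCurves.Disegni2020
  Literature.NumberTheory.EllipticCurves.TateCurve
  Summit.BirchSwinnertonDyer.BirchSwinnertonDyer.Rank1Residual.IntModel
  Summit.BirchSwinnertonDyer.BirchSwinnertonDyer.Rank1Residual.X11RankOne
  Summit.BirchSwinnertonDyer.Rank1Residual.X11b
  Summit.BirchSwinnertonDyer.Rank1Residual.X1.CongruenceTransfer
  Summit.BirchSwinnertonDyer.Rank1Residual.X2.LocalDeltaCalculus
  Summit.BirchSwinnertonDyer.Rank1Residual.X2
  Summit.BirchSwinnertonDyer.Rank1Residual.X2.RouteGSplitDisplay80934e1Local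
  Summit.BirchSwinnertonDyer.Rank1Residual
  Summit.BirchSwinnertonDyer.Rank1Residual.X1
  Summit.BirchSwinnertonDyer.BirchSwinnertonDyer.Theses
  Summit.BirchSwinnertonDyer.BirchSwinnertonDyer.Theorems.EisensteinPrimesMazurMCOnCellBTwistbackOnePartnerCertificates

namespace Summit.BirchSwinnertonDyer.BirchSwinnertonDyer.Theorems.EisensteinPrimesMazurMCOnCellBTwistbackDisplays10

namespace Cell194025s1

open Summit.BirchSwinnertonDyer.Rank1Residual.X2.RouteGSplitDisplay194025s1Local

/-! ### Cell `(194025s1, 3)` — partner field `ℚ(√-179)`, partner `Wd = 194025s1 ⊗ χ_{-179} = [0, -1, 1, 242578138867, -32156772607792582]` -/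

/-- `x₀ = 602` is a rational root of `Ψ₃(194025s1)`. [folklore] -/
theorem eval_Ψ₃_194025s1 : (⟨0, -1, 1, 7570867, 5604240293⟩ : WeierstrassCurve ℚ).Ψ₃.eval 602 = 0 := by
  norm_num [WeierstrassCurve.Ψ₃, WeierstrassCurve.b₂, WeierstrassCurve.b₄, WeierstrassCurve.b₆,
    WeierstrassCurve.b₈]

/-- **`¬ GVPar (194025s1) 3` in the kernel, from the abscissa alone** (`x₀ = 602 ∈ ℤ`, `b₂ + 12x₀ = 7220 > 0`;
`KernelDisc.gvPar_three_iff_abscissa_of_mult`, Tate uniformisation discharged). [cite: SilvermanATAEC1994, Thm. V.5.3 and Cor. V.5.4] -/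
theorem not_gvPar_194025s1 : ¬ GVPar (⟨0, -1, 1, 7570867, 5604240293⟩ : WeierstrassCurve ℚ) 3 := by
  haveI := isElliptic_194025s1
  haveI := isGloballyMinimal_194025s1
  intro h
  have key := (KernelDisc.gvPar_three_iff_abscissa_of_mult
    (W := (⟨0, -1, 1, 7570867, 5604240293⟩ : WeierstrassCurve ℚ))
    Silverman1994_thmV53_tateUniformisation_holds Silverman1994_thmV53_corV54_tateUniformisation_holds
    nonsplit_194025s1.1 eval_Ψ₃_194025s1).mp h
  norm_num [WeierstrassCurve.b₂] at key

/-- `X2.CellB (194025s1) 3` from the rank reading. [folklore] -/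
theorem cellB_194025s1_of_analyticRank (hr : (⟨0, -1, 1, 7570867, 5604240293⟩ : WeierstrassCurve ℚ).analyticRank = 0) :
    X2.CellB (⟨0, -1, 1, 7570867, 5604240293⟩ : WeierstrassCurve ℚ) 3 :=
  ⟨hr, ⟨by decide, not_irreducible_194025s1, nonsplit_194025s1.1⟩, not_gvPar_194025s1⟩

/-- `Wd = [0, -1, 1, 242578138867, -32156772607792582]` (PARI `ellminimalmodel(elltwist(194025s1, -179))`, kit j311785; conductor `194025·179² = 6216755025`) is elliptic. [folklore] -/
theorem isElliptic_twist : (⟨0, -1, 1, 242578138867, -32156772607792582⟩ : WeierstrassCurve ℚ).IsElliptic :=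
  isElliptic_of_discOf_ne_zero 0 (-1) 1 242578138867 (-32156772607792582) (by decide +kernel)

set_option maxRecDepth 100000 in
/-- `[0, -1, 1, 242578138867, -32156772607792582]` is globally minimal: Kraus–Silverman at every prime — a prime not dividing `Δ` cannot have `q¹² ∣ Δ`, and the
primes of `|Δ| = 3^18 · 5^12 · 13^3 · 179^6 · 199` are checked one by one (`decide`; tree `isGloballyMinimal_of_krausCriterion`). [cite: SilvermanAEC2009, VII.1 Remark 1.1] -/
theorem isGloballyMinimal_twist : (⟨0, -1, 1, 242578138867, -32156772607792582⟩ : WeierstrassCurve ℚ).IsGloballyMinimal := by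
  refine isGloballyMinimal_of_krausCriterion 0 (-1) 1 242578138867 (-32156772607792582) fun q hq ↦ ?_
  by_cases hd : q ∣ (discOf [0, -1, 1, 242578138867, -32156772607792582]).natAbs
  · have hfac : (discOf [0, -1, 1, 242578138867, -32156772607792582]).natAbs = 3 ^ 18 * (5 ^ 12 * (13 ^ 3 * (179 ^ 6 * (199)))) := by decide +kernel
    rw [hfac] at hd
    rcases (Nat.Prime.dvd_mul hq).mp hd with h0 | r0
    · obtain rfl := (Nat.prime_dvd_prime_iff_eq hq Nat.prime_three).mp (hq.dvd_of_dvd_pow h0)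
      exact Or.inl (Or.inr (by decide +kernel))
    rcases (Nat.Prime.dvd_mul hq).mp r0 with h1 | r1
    · obtain rfl := (Nat.prime_dvd_prime_iff_eq hq Nat.prime_five).mp (hq.dvd_of_dvd_pow h1)
      exact Or.inl (Or.inr (by decide +kernel))
    rcases (Nat.Prime.dvd_mul hq).mp r1 with h2 | r2
    · obtain rfl := (Nat.prime_dvd_prime_iff_eq hq (by norm_num)).mp (hq.dvd_of_dvd_pow h2)
      exact Or.inl (Or.inl (by decide +kernel))
    rcases (Nat.Prime.dvd_mul hq).mp r2 with h3 | r3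
    · obtain rfl := (Nat.prime_dvd_prime_iff_eq hq (by norm_num)).mp (hq.dvd_of_dvd_pow h3)
      exact Or.inl (Or.inl (by decide +kernel))
    obtain rfl := (Nat.prime_dvd_prime_iff_eq hq (by norm_num)).mp r3
    exact Or.inl (Or.inl (by decide +kernel))
  · refine Or.inl (Or.inl fun h12 ↦ hd ?_)
    have h' : ((q ^ 12 : ℕ) : ℤ) ∣ discOf [0, -1, 1, 242578138867, -32156772607792582] := by exact_mod_cast h12
    exact (dvd_pow_self q (by norm_num)).trans (Int.natCast_dvd.mp h')

/-- The twist identity `⟨1, -60, 0, 1/2⟩⁻¹ • Wd = 194025s1.quadraticTwist (-179)`. [folklore] -/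
theorem exists_variableChange_twist :
    ∃ C : VariableChange ℚ, C • (⟨0, -1, 1, 242578138867, -32156772607792582⟩ : WeierstrassCurve ℚ) =
      (⟨0, -1, 1, 7570867, 5604240293⟩ : WeierstrassCurve ℚ).quadraticTwist ((-179 : ℤ) : ℚ) := by
  refine ⟨(⟨1, -60, 0, 1/2⟩ : VariableChange ℚ)⁻¹, ?_⟩
  rw [inv_smul_eq_iff]
  ext <;> norm_num [quadraticTwist, WeierstrassCurve.variableChange_a₁,
    WeierstrassCurve.variableChange_a₂, WeierstrassCurve.variableChange_a₃,
    WeierstrassCurve.variableChange_a₄, WeierstrassCurve.variableChange_a₆, WeierstrassCurve.b₂,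
    WeierstrassCurve.b₄, WeierstrassCurve.b₆]

/-- The primes dividing `194025 = 3·5²·13·199`. [folklore] -/
theorem eq_of_prime_dvd_194025 {q : ℕ} (hq : q.Prime) (h : q ∣ 194025) : q = 3 ∨ q = 5 ∨ q = 13 ∨ q = 199 := by
  have h' : q ∣ 3 * (5 ^ 2 * (13 * (199))) := by norm_num at h ⊢; exact h
  rcases (Nat.Prime.dvd_mul hq).mp h' with h0 | r0
  · exact Or.inl ((Nat.prime_dvd_prime_iff_eq hq Nat.prime_three).mp h0)
  rcases (Nat.Prime.dvd_mul hq).mp r0 with h1 | r1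
  · exact Or.inr (Or.inl ((Nat.prime_dvd_prime_iff_eq hq Nat.prime_five).mp (hq.dvd_of_dvd_pow h1)))
  rcases (Nat.Prime.dvd_mul hq).mp r1 with h2 | r2
  · exact Or.inr (Or.inr (Or.inl ((Nat.prime_dvd_prime_iff_eq hq (by norm_num)).mp h2)))
  exact Or.inr (Or.inr (Or.inr ((Nat.prime_dvd_prime_iff_eq hq (by norm_num)).mp r2)))

/-- Heegner hypothesis for `N = 194025` in any quadratic field of discriminant `-179` (Kronecker criterion; `(-179/3) = +1`, `(-179/5) = +1`, `(-179/13) = +1`, `(-179/199) = +1`). [cite: GrossLMS1991, §1 (p. 235)] -/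
theorem satisfiesHeegnerHypothesis_N {K : Type} [Field K] [NumberField K]
    (h2 : Module.finrank ℚ K = 2) (hdK : NumberField.discr K = -179) : SatisfiesHeegnerHypothesis 194025 K := by
  refine (satisfiesHeegnerHypothesis_iff_kronecker 194025 K h2).mpr fun p hp hpN ↦ ?_
  rw [hdK]
  rcases eq_of_prime_dvd_194025 hp hpN with rfl | rfl | rfl | rfl <;> norm_num

/-- **PER-PAIR DISPLAY (door p640749 §4): `X2.MazurMainConjectureAt (194025s1) 3`** from `PublishedInputs` + Disegni Thm 4(1) BY NAME;
PER PAIR the Heegner datum over a quadratic `K` with `d_K = -179` (`Dt H ι P hPt hcM`), STEP L there (`hlow` = -27489 ⇐ KY Thm D [PRE]),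
and the READINGS `hr` (`r_an = 0`), `hN` (`N = 194025`), `hrd` (`r_an(Wd) = 1`, PARI j311785, `L′(Wd,1) = 1.8011245810…`) and `hordL`
(`ord_{T=0} ϖL₃(Wd) = 1` for THE non-split Mazur–Tate–Teitelbaum function; reading of record: ENGINE T (0,3)@5; v₃(L′(0)) = 2; λ_pred = 3).
Kernel: `X2.CellB`, non-split `3`, the `K`-clauses, the twist identity, minimality of `Wd`. Nothing booked; MC / BSD proved for no curve
unconditionally. [cite: GreenbergVatsal2000, Thm. (1.3) with pp. 14–15] [cite: Disegni2020, Thm. 4 (§3.2)] [cite: SteinWuthrich2013, Thm. 6.1 (p. 20)]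
[cite: Wuthrich2014, Thm. 16 (p. 397)] [cite: JetchevSkinnerWan2017, §7.4.1] -/
theorem mazurMainConjectureAt_194025s1_at_three_of_partner_orderOne
    (hP : EisensteinPrimes.PublishedInputs) (hDis : padicBSD_rankOne_nonsplitMult)
    (W : WeierstrassCurve ℚ) [W.IsElliptic] [W.IsGloballyMinimal] (hW : W = ⟨0, -1, 1, 7570867, 5604240293⟩)
    (hr : W.analyticRank = 0)
    (K : Type) [Field K] [NumberField K] (h2 : Module.finrank ℚ K = 2) (hdK : NumberField.discr K = -179)
    (Dt : ModularParametrizationData W 194025) (H : HeegnerDatum 194025 (NumberField.discr K)) (ι : K →+* ℂ)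
    (P : (W.baseChange K).toAffine.Point) (hN : W.conductorNorm ℤ = 194025)
    (hPt : WeierstrassCurve.Affine.Point.map ι.toRatAlgHom P = heegnerPointComplex Dt H)
    (hcM : ¬ ((3 : ℕ) : ℤ) ∣ Dt.c)
    (Wd : WeierstrassCurve ℚ) [Wd.IsElliptic] [Wd.IsGloballyMinimal]
    (hWd : Wd = ⟨0, -1, 1, 242578138867, -32156772607792582⟩) (hrd : Wd.analyticRank = 1)
    (hlow : Finite (W.baseChange K).sha → X11b.IndexLowerBoundAt W 3 K P)
    (hordL : ∀ {M : ℕ} [NeZero M] (f : CuspForm (Gamma0 M) 2), IsNewformOf Wd f →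
      ∀ (ϖ : ℚ), (ϖ : ℝ) * Wd.realPeriodRat = plusPeriod f →
      ∀ L : PowerSeries ℚ_[3], IsMultPAdicLFunctionOf f 3 (-1) L → L.order = ((1 : ℕ) : ℕ∞)) :
    X2.MazurMainConjectureAt W 3 := by
  subst hW hWd
  have hK : IsImaginaryQuadratic K := isImaginaryQuadratic_of_discr_eq_of_neg h2 hdK (by norm_num)
  have hodd : Odd (NumberField.discr K) := by rw [hdK]; exact ⟨-90, by norm_num⟩
  have hlt : NumberField.discr K < -4 := by rw [hdK]; norm_num
  have hWd' : ∃ C : VariableChange ℚ, C • (⟨0, -1, 1, 242578138867, -32156772607792582⟩ : WeierstrassCurve ℚ) =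
      (⟨0, -1, 1, 7570867, 5604240293⟩ : WeierstrassCurve ℚ).quadraticTwist (NumberField.discr K : ℚ) := by
    rw [hdK]; exact exists_variableChange_twist
  exact mazurMainConjectureAt_of_cellB_of_not_split_of_indexLowerBoundAt_of_orderOne_twist hP hDis _ 3
    (cellB_194025s1_of_analyticRank hr) nonsplit_194025s1.2 194025 K Dt H ι P hK hodd hlt hN
    (satisfiesHeegnerHypothesis_N h2 hdK)
    (DoubleTwistDisplayKit.satisfiesHeegnerHypothesis_three_of_discr (-179) (by norm_num) K h2 hdK) hPt hcM _ hWd' hrd hlow hordL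

end Cell194025s1

namespace Cell206016bb1

open Summit.BirchSwinnertonDyer.Rank1Residual.X2.RouteGSplitDisplay206016bb1Local

/-! ### Cell `(206016bb1, 3)` — partner field `ℚ(√-71)`, partner `Wd = 206016bb1 ⊗ χ_{-71} = [0, -1, 0, 16184971, 272340803181]` -/

/-- `x₀ = 131` is a rational root of `Ψ₃(206016bb1)`. [folklore] -/
theorem eval_Ψ₃_206016bb1 : (⟨0, -1, 0, 3211, -762003⟩ : WeierstrassCurve ℚ).Ψ₃.eval 131 = 0 := by
  norm_num [WeierstrassCurve.Ψ₃, WeierstrassCurve.b₂, WeierstrassCurve.b₄, WeierstrassCurve.b₆,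
    WeierstrassCurve.b₈]

/-- **`¬ GVPar (206016bb1) 3` in the kernel, from the abscissa alone** (`x₀ = 131 ∈ ℤ`, `b₂ + 12x₀ = 1568 > 0`;
`KernelDisc.gvPar_three_iff_abscissa_of_mult`, Tate uniformisation discharged). [cite: SilvermanATAEC1994, Thm. V.5.3 and Cor. V.5.4] -/
theorem not_gvPar_206016bb1 : ¬ GVPar (⟨0, -1, 0, 3211, -762003⟩ : WeierstrassCurve ℚ) 3 := by
  haveI := isElliptic_206016bb1
  haveI := isGloballyMinimal_206016bb1
  intro h
  have key := (KernelDisc.gvPar_three_iff_abscissa_of_mult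
    (W := (⟨0, -1, 0, 3211, -762003⟩ : WeierstrassCurve ℚ))
    Silverman1994_thmV53_tateUniformisation_holds Silverman1994_thmV53_corV54_tateUniformisation_holds
    nonsplit_206016bb1.1 eval_Ψ₃_206016bb1).mp h
  norm_num [WeierstrassCurve.b₂] at key

/-- `X2.CellB (206016bb1) 3` from the rank reading. [folklore] -/
theorem cellB_206016bb1_of_analyticRank (hr : (⟨0, -1, 0, 3211, -762003⟩ : WeierstrassCurve ℚ).analyticRank = 0) :
    X2.CellB (⟨0, -1, 0, 3211, -762003⟩ : WeierstrassCurve ℚ) 3 :=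
  ⟨hr, ⟨by decide, not_irreducible_206016bb1, nonsplit_206016bb1.1⟩, not_gvPar_206016bb1⟩

/-- `Wd = [0, -1, 0, 16184971, 272340803181]` (PARI `ellminimalmodel(elltwist(206016bb1, -71))`, kit j311785; conductor `206016·71² = 1038526656`) is elliptic. [folklore] -/
theorem isElliptic_twist : (⟨0, -1, 0, 16184971, 272340803181⟩ : WeierstrassCurve ℚ).IsElliptic :=
  isElliptic_of_discOf_ne_zero 0 (-1) 0 16184971 272340803181 (by decide +kernel)

-- NOTE: global minimality of `Wd` is NOT re-derived here (its 2- or 3-adic type lies outside the Kraus patterns F2a/F2b/F3 of the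
-- tree's `isGloballyMinimal_of_krausCriterion`); the display takes `[Wd.IsGloballyMinimal]` as an instance hypothesis = the PARI
-- `ellminimalmodel` reading (kit j311785).

/-- The twist identity `⟨1, -24, 0, 0⟩⁻¹ • Wd = 206016bb1.quadraticTwist (-71)`. [folklore] -/
theorem exists_variableChange_twist :
    ∃ C : VariableChange ℚ, C • (⟨0, -1, 0, 16184971, 272340803181⟩ : WeierstrassCurve ℚ) =
      (⟨0, -1, 0, 3211, -762003⟩ : WeierstrassCurve ℚ).quadraticTwist ((-71 : ℤ) : ℚ) := by
  refine ⟨(⟨1, -24, 0, 0⟩ : VariableChange ℚ)⁻¹, ?_⟩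
  rw [inv_smul_eq_iff]
  ext <;> norm_num [quadraticTwist, WeierstrassCurve.variableChange_a₁,
    WeierstrassCurve.variableChange_a₂, WeierstrassCurve.variableChange_a₃,
    WeierstrassCurve.variableChange_a₄, WeierstrassCurve.variableChange_a₆, WeierstrassCurve.b₂,
    WeierstrassCurve.b₄, WeierstrassCurve.b₆]

/-- The primes dividing `206016 = 2⁶·3·29·37`. [folklore] -/
theorem eq_of_prime_dvd_206016 {q : ℕ} (hq : q.Prime) (h : q ∣ 206016) : q = 2 ∨ q = 3 ∨ q = 29 ∨ q = 37 := by
  have h' : q ∣ 2 ^ 6 * (3 * (29 * (37))) := by norm_num at h ⊢; exact h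
  rcases (Nat.Prime.dvd_mul hq).mp h' with h0 | r0
  · exact Or.inl ((Nat.prime_dvd_prime_iff_eq hq Nat.prime_two).mp (hq.dvd_of_dvd_pow h0))
  rcases (Nat.Prime.dvd_mul hq).mp r0 with h1 | r1
  · exact Or.inr (Or.inl ((Nat.prime_dvd_prime_iff_eq hq Nat.prime_three).mp h1))
  rcases (Nat.Prime.dvd_mul hq).mp r1 with h2 | r2
  · exact Or.inr (Or.inr (Or.inl ((Nat.prime_dvd_prime_iff_eq hq (by norm_num)).mp h2)))
  exact Or.inr (Or.inr (Or.inr ((Nat.prime_dvd_prime_iff_eq hq (by norm_num)).mp r2)))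

/-- Heegner hypothesis for `N = 206016` in any quadratic field of discriminant `-71` (Kronecker criterion: `-71 ≡ 1 (mod 8)`; `(-71/3) = +1`, `(-71/29) = +1`, `(-71/37) = +1`). [cite: GrossLMS1991, §1 (p. 235)] -/
theorem satisfiesHeegnerHypothesis_N {K : Type} [Field K] [NumberField K]
    (h2 : Module.finrank ℚ K = 2) (hdK : NumberField.discr K = -71) : SatisfiesHeegnerHypothesis 206016 K := by
  refine (satisfiesHeegnerHypothesis_iff_kronecker 206016 K h2).mpr fun p hp hpN ↦ ?_
  rw [hdK]
  rcases eq_of_prime_dvd_206016 hp hpN with rfl | rfl | rfl | rfl <;> norm_num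

/-- **PER-PAIR DISPLAY (door p642512 §5): `X2.MazurMainConjectureAt (206016bb1) 3`** from `PublishedInputs` + Disegni Thm 4(1) BY NAME;
PER PAIR the Heegner datum over a quadratic `K` with `d_K = -71` (`Dt H ι P hPt hcM`), STEP L there (`hlow` = -27489 ⇐ KY Thm D [PRE]),
and the READINGS `hr` (`r_an = 0`, Cremona), `hN` (`N = 206016`, Cremona), `hrd` (`r_an(Wd) = 1`, PARI `ellanalyticrank` j311785, `L′(Wd,1) = 21.143704664…`),
`hμ0`/`hlam` (`(μ_an, λ_an)(Wd, 3) = (0, 1)`; readings of record: ENGINE T (0,1)@5; v₃(L′(0)) = 0; predicted `(0, 1 + 2·λ₃(ℚ(√-568)) = 1)`).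
Kernel: `X2.CellB`, non-split `3`, the `K`-clauses, the twist identity. Nothing booked; MC / BSD proved for no curve
unconditionally. [cite: GreenbergVatsal2000, Thm. (1.3) with pp. 14–15] [cite: Disegni2020, Thm. 4 (§3.2)] [cite: SteinWuthrich2013, Thm. 6.1 (p. 20)]
[cite: Wuthrich2014, Thm. 16 (p. 397)] [cite: JetchevSkinnerWan2017, §7.4.1] -/
theorem mazurMainConjectureAt_206016bb1_at_three_of_partner
    (hP : EisensteinPrimes.PublishedInputs) (hDis : padicBSD_rankOne_nonsplitMult)
    (W : WeierstrassCurve ℚ) [W.IsElliptic] [W.IsGloballyMinimal] (hW : W = ⟨0, -1, 0, 3211, -762003⟩)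
    (hr : W.analyticRank = 0)
    (K : Type) [Field K] [NumberField K] (h2 : Module.finrank ℚ K = 2) (hdK : NumberField.discr K = -71)
    (Dt : ModularParametrizationData W 206016) (H : HeegnerDatum 206016 (NumberField.discr K)) (ι : K →+* ℂ)
    (P : (W.baseChange K).toAffine.Point) (hN : W.conductorNorm ℤ = 206016)
    (hPt : WeierstrassCurve.Affine.Point.map ι.toRatAlgHom P = heegnerPointComplex Dt H)
    (hcM : ¬ ((3 : ℕ) : ℤ) ∣ Dt.c)
    (Wd : WeierstrassCurve ℚ) [Wd.IsElliptic] [Wd.IsGloballyMinimal]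
    (hWd : Wd = ⟨0, -1, 0, 16184971, 272340803181⟩) (hrd : Wd.analyticRank = 1)
    (hlow : Finite (W.baseChange K).sha → X11b.IndexLowerBoundAt W 3 K P)
    (hμ0 : X2.AnalyticMuLE Wd 3 0) (hlam : X2.AnalyticLambdaEq Wd 3 1) :
    X2.MazurMainConjectureAt W 3 := by
  subst hW hWd
  have hK : IsImaginaryQuadratic K := isImaginaryQuadratic_of_discr_eq_of_neg h2 hdK (by norm_num)
  have hodd : Odd (NumberField.discr K) := by rw [hdK]; exact ⟨-36, by norm_num⟩
  have hlt : NumberField.discr K < -4 := by rw [hdK]; norm_num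
  have hWd' : ∃ C : VariableChange ℚ, C • (⟨0, -1, 0, 16184971, 272340803181⟩ : WeierstrassCurve ℚ) =
      (⟨0, -1, 0, 3211, -762003⟩ : WeierstrassCurve ℚ).quadraticTwist (NumberField.discr K : ℚ) := by
    rw [hdK]; exact exists_variableChange_twist
  exact mazurMainConjectureAt_of_cellB_of_not_split_of_indexLowerBoundAt_of_lamMin_twist hP hDis _ 3
    (cellB_206016bb1_of_analyticRank hr) nonsplit_206016bb1.2 206016 K Dt H ι P hK hodd hlt hN
    (satisfiesHeegnerHypothesis_N h2 hdK)
    (DoubleTwistDisplayKit.satisfiesHeegnerHypothesis_three_of_discr (-71) (by norm_num) K h2 hdK) hPt hcM _ hWd' hrd hlow hμ0 hlam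

end Cell206016bb1

end Summit.BirchSwinnertonDyer.BirchSwinnertonDyer.Theorems.EisensteinPrimesMazurMCOnCellBTwistbackDisplays10

end
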